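import Mathlib.Analysis.Analytic.OfScalars
import Mathlib.Analysis.Analytic.ChangeOrigin
import Mathlib.Analysis.Calculus.SmoothSeries
import Mathlib.Analysis.Normed.Ring.InfiniteSum
import Mathlib.Analysis.SpecificLimits.Normed
import Mathlib.Analysis.Calculus.Deriv.Pow
import Mathlib.Combinatorics.Enumerative.Catalan.Basic
import HarnessLib

/-!
# Buckmaster–Cao-Labora–Gómez-Serrano at `γ = 5/3`: the power series of the profile at `ζ = 0`

Topic `Literature/Analysis/FluidPDE`; namespace
`Literature.Analysis.FluidPDE.BuckmasterCaolaboraGomezserrano2025.OriginSeries`. Companion of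
`CompressibleEulerImplosion.lean` (named fact `BuckmasterCaolaboraGomezserrano2025_thm11_monatomic`,
THEOREM 1.1 of T. Buckmaster, G. Cao-Labora, J. Gómez-Serrano, *Smooth imploding solutions for 3D
compressible fluids*, Forum Math. Pi 13 (2025) e6, arXiv:2208.09445, at `γ = 5/3`, `α = 1/3`).
Brick D1 of the discharge plan: the FIRST HALF of Proposition 2.5 ("Taylor expansion around
`P₀`"): "For any `A > 0`, there exists a solution `𝒲` to (1.10) in a neighborhood of `ζ = 0`
which can be written in terms of a convergent power series `𝒲(ζ) = ∑ᵢ wᵢ ζⁱ` such that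
`w₀ = A`", for the single profile equation (1.10) at `α = 1/3`,

  `(r−1)𝒲(ζ) + (ζ + ½(𝒲(ζ) − 𝒲(−ζ) + ⅓(𝒲(ζ) + 𝒲(−ζ)))) 𝒲′(ζ) + (1/(6ζ))(𝒲(ζ)² − 𝒲(−ζ)²) = 0`,

following the printed proof: the coefficients are forced by the recursion (2.12)
(`α w₀ (n + 1 + 2·𝟙_{2∣n}) w_{n+1} = ḡ_n − ∑_{i<n} (i+1) v_{n−i} w_{i+1}`, here `w`, `rest`, `lead`,
`w_succ`, `ee_w`), they obey a Catalan-number majorant `|wᵢ| ≤ B 𝔠ᵢ Lⁱ⁻¹` (`abs_w_le_catalan`,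
the paper's induction `|wᵢ| + |ḡᵢ| + |vᵢ| ≤ 𝔠ᵢ Mⁱ⁻¹`), hence `|wᵢ| ≤ K Mⁱ` and the series has a
positive radius; inside it the series solves (1.10) because the coefficient of `ζⁿ⁺¹` of
`ζ·[(r−1)𝒲 + 𝒱𝒲′] + ⅙(𝒲(ζ)² − 𝒲(−ζ)²)` is exactly the quantity `e_n` annihilated by the recursion
(Cauchy products, `profile_eq`). Main statement: `exists_originSeries`. The value of `A` is any
nonzero real (the paper takes `A > 0`); `α = 1/3` throughout (TODO(general form): general
`α = (γ−1)/2`). Everything is PROVED; no facts.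
[cite: BuckmasterCaolaboraGomezserrano2025, Prop. 2.5, eqs. (2.11)–(2.12), (1.10)]
-/

noncomputable section

open Finset Filter Topology

namespace Literature.Analysis.FluidPDE

namespace BuckmasterCaolaboraGomezserrano2025

namespace OriginSeries

/-! ### The coefficient recursion (2.11)–(2.12) at `α = 1/3` -/

/-- `cᵢ = 1` for odd `i`, `α = 1/3` for even `i`: with `vᵢ = 𝟙_{i=1} + cᵢ wᵢ` these are the Taylor
coefficients of `𝒱 = ζ + ½(𝒲(ζ) − 𝒲(−ζ) + α(𝒲(ζ) + 𝒲(−ζ)))` (eq. (2.11):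
`vᵢ = 𝟙_{i=1} + (wᵢ/2)(1 + α + (1−α)(−1)^{i+1})`). [cite: BuckmasterCaolaboraGomezserrano2025, eq. (2.11)] -/
def cc (i : ℕ) : ℝ := if Even i then 1 / 3 else 1

/-- `vᵢ(f) = 𝟙_{i=1} + cᵢ fᵢ`. [cite: BuckmasterCaolaboraGomezserrano2025, eq. (2.11)] -/
def vv (f : ℕ → ℝ) (i : ℕ) : ℝ := (if i = 1 then 1 else 0) + cc i * f i

/-- `dⱼ(f) = (j+1) f_{j+1}`: Taylor coefficients of `𝒲′`. [folklore] -/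
def dd (f : ℕ → ℝ) (j : ℕ) : ℝ := ((j : ℝ) + 1) * f (j + 1)

/-- `e_n(f)`: the coefficient of `ζⁿ⁺¹` in `ζ((r−1)𝒲 + 𝒱𝒲′) + ⅙(𝒲(ζ)² − 𝒲(−ζ)²)` for
`𝒲 = ∑ fᵢ ζⁱ` (eq. (2.11): `𝒱 ∂_ζ𝒲 = 𝒢`). [cite: BuckmasterCaolaboraGomezserrano2025, eq. (2.11)] -/
def ee (r : ℝ) (f : ℕ → ℝ) (n : ℕ) : ℝ :=
  (r - 1) * f n + ∑ k ∈ range (n + 1), vv f k * dd f (n - k)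
    + 1 / 6 * (1 - (-1) ^ (n + 1)) * ∑ k ∈ range (n + 2), f k * f (n + 1 - k)

/-- `e_n(f)` minus its two terms containing `f_{n+1}` (the right-hand side of (2.12) up to sign).
[cite: BuckmasterCaolaboraGomezserrano2025, eq. (2.12)] -/
def rest (r : ℝ) (f : ℕ → ℝ) (n : ℕ) : ℝ :=
  (r - 1) * f n + ∑ k ∈ range n, vv f (k + 1) * dd f (n - (k + 1))
    + 1 / 6 * (1 - (-1) ^ (n + 1)) * ∑ k ∈ range n, f (k + 1) * f (n - k)

/-- The coefficient of `f_{n+1}` in `e_n(f)`: `(f₀/3)(n + 1 + (1 − (−1)ⁿ⁺¹)) = α w₀ (n+1+2·𝟙_{2∣n})`.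
[cite: BuckmasterCaolaboraGomezserrano2025, eq. (2.12)] -/
def lead (f : ℕ → ℝ) (n : ℕ) : ℝ :=
  f 0 / 3 * ((n : ℝ) + 1) + 1 / 6 * (1 - (-1) ^ (n + 1)) * (2 * f 0)

/-- [cite: BuckmasterCaolaboraGomezserrano2025, eq. (2.12)] -/
theorem lead_eq (f : ℕ → ℝ) (n : ℕ) :
    lead f n = f 0 / 3 * ((n : ℝ) + 1 + (1 - (-1) ^ (n + 1))) := by
  unfold lead; ring

/-- `|lead| ≥ |f₀| (n+1)/3`. [folklore] -/
theorem abs_lead_ge (f : ℕ → ℝ) (n : ℕ) : |f 0| / 3 * ((n : ℝ) + 1) ≤ |lead f n| := by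
  rw [lead_eq, abs_mul, abs_div, abs_of_pos (by norm_num : (0:ℝ) < 3)]
  have h1 : (0 : ℝ) ≤ 1 - (-1) ^ (n + 1) := by
    rcases neg_one_pow_eq_or ℝ (n + 1) with h | h <;> rw [h] <;> norm_num
  have h2 : ((n : ℝ) + 1) ≤ |(n : ℝ) + 1 + (1 - (-1) ^ (n + 1))| := by
    rw [abs_of_nonneg (by positivity)]; linarith
  exact mul_le_mul_of_nonneg_left h2 (by positivity)

/-- Splitting off the `f_{n+1}` terms: `e_n(f) = lead(f,n) f_{n+1} + rest(f,n)`.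
[cite: BuckmasterCaolaboraGomezserrano2025, eq. (2.12)] -/
theorem ee_eq (r : ℝ) (f : ℕ → ℝ) (n : ℕ) : ee r f n = lead f n * f (n + 1) + rest r f n := by
  unfold ee rest lead
  rw [sum_range_succ' (fun k => vv f k * dd f (n - k)),
    sum_range_succ' (fun k => f k * f (n + 1 - k)),
    sum_range_succ (fun k => f (k + 1) * f (n + 1 - (k + 1)))]
  have h1 : ∀ k, n + 1 - (k + 1) = n - k := fun k => by omega
  simp only [h1, Nat.sub_zero, Nat.sub_self, vv, dd, cc, Even.zero]
  norm_num
  ring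

/-! ### The coefficients `wᵢ` (forced by `e_n = 0`, `w₀ = A`) -/

/-- The forced value of `w_{n+1}` given `w₀, …, w_n`. [cite: BuckmasterCaolaboraGomezserrano2025, eq. (2.12)] -/
def next (r : ℝ) (f : ℕ → ℝ) (n : ℕ) : ℝ := -rest r f n / lead f n

/-- Prefixes of the coefficient sequence (plain structural recursion). [folklore] -/
def pre (r A : ℝ) : ℕ → ℕ → ℝ
  | 0 => fun i => if i = 0 then A else 0
  | n + 1 => fun i => if i ≤ n then pre r A n i else next r (pre r A n) n

/-- **The Taylor coefficients `wᵢ` of the profile at `ζ = 0`** with `w₀ = A` (eq. (2.12) at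
`α = 1/3`). [cite: BuckmasterCaolaboraGomezserrano2025, Prop. 2.5, eq. (2.12)] -/
def w (r A : ℝ) (n : ℕ) : ℝ := pre r A n n

variable {r A : ℝ}

/-- [cite: BuckmasterCaolaboraGomezserrano2025, Prop. 2.5] -/
@[simp] theorem w_zero : w r A 0 = A := by simp [w, pre]

/-- [folklore] -/
theorem pre_eq_w : ∀ n i : ℕ, i ≤ n → pre r A n i = w r A i
  | 0, i, hi => by
    obtain rfl : i = 0 := Nat.le_zero.mp hi
    rfl
  | n + 1, i, hi => by
    by_cases h : i ≤ n
    · simp only [pre, if_pos h]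
      exact pre_eq_w n i h
    · obtain rfl : i = n + 1 := by omega
      rfl

/-- [folklore] -/
theorem rest_congr {f g : ℕ → ℝ} {n : ℕ} (h : ∀ i ≤ n, f i = g i) : rest r f n = rest r g n := by
  unfold rest
  have hv : ∀ k ∈ range n, vv f (k + 1) * dd f (n - (k + 1)) = vv g (k + 1) * dd g (n - (k + 1)) := by
    intro k hk
    rw [mem_range] at hk
    simp only [vv, dd, h (k + 1) (by omega), h (n - (k + 1) + 1) (by omega)]
  have hp : ∀ k ∈ range n, f (k + 1) * f (n - k) = g (k + 1) * g (n - k) := by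
    intro k hk
    rw [mem_range] at hk
    rw [h (k + 1) (by omega), h (n - k) (by omega)]
  rw [sum_congr rfl hv, sum_congr rfl hp, h n le_rfl]

/-- [folklore] -/
theorem lead_congr {f g : ℕ → ℝ} {n : ℕ} (h : f 0 = g 0) : lead f n = lead g n := by
  unfold lead; rw [h]

/-- **The recursion (2.12).** [cite: BuckmasterCaolaboraGomezserrano2025, eq. (2.12)] -/
theorem w_succ (n : ℕ) : w r A (n + 1) = next r (w r A) n := by
  show pre r A (n + 1) (n + 1) = _
  simp only [pre, show ¬ (n + 1 ≤ n) from by omega, if_false]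
  unfold next
  rw [rest_congr (fun i hi => pre_eq_w n i hi), lead_congr (pre_eq_w n 0 (Nat.zero_le n))]

/-- [folklore] -/
theorem lead_w (n : ℕ) : lead (w r A) n = A / 3 * ((n : ℝ) + 1 + (1 - (-1) ^ (n + 1))) := by
  rw [lead_eq, w_zero]

/-- [folklore] -/
theorem lead_w_ne (hA : A ≠ 0) (n : ℕ) : lead (w r A) n ≠ 0 := by
  intro h
  have := abs_lead_ge (w r A) n
  rw [h, abs_zero, w_zero] at this
  have hA' : 0 < |A| := abs_pos.mpr hA
  have : (0 : ℝ) < |A| / 3 * ((n : ℝ) + 1) := by positivity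
  linarith

/-- **`e_n(w) = 0` for all `n`**: the formal power series `∑ wᵢ ζⁱ` solves (1.10) formally.
[cite: BuckmasterCaolaboraGomezserrano2025, Prop. 2.5] -/
theorem ee_w (hA : A ≠ 0) (n : ℕ) : ee r (w r A) n = 0 := by
  rw [ee_eq, w_succ]
  unfold next
  have := lead_w_ne (r := r) hA n
  field_simp
  ring

/-- `w₁ = −(r−1)·w₀/(3·α w₀) = 1 − r` (the radial velocity slope at the origin). [cite: BuckmasterCaolaboraGomezserrano2025, Prop. 2.5] -/
theorem w_one (hA : A ≠ 0) : w r A 1 = 1 - r := by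
  rw [show (1 : ℕ) = 0 + 1 from rfl, w_succ]
  unfold next rest
  rw [lead_w, w_zero]
  simp
  field_simp
  ring

/-! ### The Catalan majorant (proof of Prop. 2.5, analyticity) -/

/-- `(n+2)𝔠ₙ₊₁ = 2(2n+1)𝔠ₙ`. [folklore] -/
theorem catalan_succ_mul (n : ℕ) : (n + 2) * catalan (n + 1) = 2 * (2 * n + 1) * catalan n := by
  have h1 := succ_mul_catalan_eq_centralBinom (n + 1)
  have h2 := succ_mul_catalan_eq_centralBinom n
  have h3 := Nat.succ_mul_centralBinom_succ n
  apply Nat.eq_of_mul_eq_mul_left (Nat.succ_pos n)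
  calc (n + 1) * ((n + 2) * catalan (n + 1)) = (n + 1) * (n + 1).centralBinom := by rw [← h1]
    _ = 2 * (2 * n + 1) * n.centralBinom := h3
    _ = 2 * (2 * n + 1) * ((n + 1) * catalan n) := by rw [h2]
    _ = (n + 1) * (2 * (2 * n + 1) * catalan n) := by ring

/-- `𝔠ₙ₊₁ ≤ 4𝔠ₙ`. [folklore] -/
theorem catalan_succ_le (n : ℕ) : (catalan (n + 1) : ℝ) ≤ 4 * catalan n := by
  have h := catalan_succ_mul n
  have h' : ((n : ℝ) + 2) * catalan (n + 1) = 2 * (2 * n + 1) * catalan n := by exact_mod_cast h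
  have hc : (0 : ℝ) ≤ catalan n := Nat.cast_nonneg _
  nlinarith

/-- `𝔠ₙ ≤ 𝔠ₙ₊₁`. [folklore] -/
theorem catalan_le_succ (n : ℕ) : (catalan n : ℝ) ≤ catalan (n + 1) := by
  have h := catalan_succ_mul n
  have h' : ((n : ℝ) + 2) * catalan (n + 1) = 2 * (2 * n + 1) * catalan n := by exact_mod_cast h
  have hc : (0 : ℝ) ≤ catalan (n + 1) := Nat.cast_nonneg _
  nlinarith

/-- `𝔠ₙ ≤ 4ⁿ`. [folklore] -/
theorem catalan_le_four_pow (n : ℕ) : (catalan n : ℝ) ≤ 4 ^ n := by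
  have h1 : catalan n ≤ (n + 1) * catalan n := Nat.le_mul_of_pos_left _ (Nat.succ_pos n)
  rw [succ_mul_catalan_eq_centralBinom] at h1
  exact_mod_cast h1.trans (Nat.centralBinom_le_four_pow n)

/-- The Catalan convolution bounds the sums met in the recursion:
`∑_{k<n} 𝔠_{k+1} 𝔠_{n−k} ≤ 𝔠ₙ₊₂`. [folklore] -/
theorem catalan_conv_le (n : ℕ) :
    ∑ k ∈ range n, (catalan (k + 1) : ℝ) * catalan (n - k) ≤ catalan (n + 2) := by
  have h : ∑ k ∈ range n, catalan (k + 1) * catalan (n - k) ≤ catalan (n + 2) := by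
    rw [catalan_succ', Nat.sum_antidiagonal_eq_sum_range_succ (fun i j => catalan i * catalan j),
      sum_range_succ', sum_range_succ]
    have h1 : ∀ k ∈ range n, catalan (k + 1) * catalan (n - k)
        = catalan (k + 1) * catalan (n + 1 - (k + 1)) := by
      intro k hk
      rw [mem_range] at hk
      congr 2
      omega
    rw [sum_congr rfl h1]
    omega
  exact_mod_cast h

/-- The basic inequality behind the majorant: with `aₙ = |wₙ|` and `C = (3|r−1| + 4)/|A|`,
`a_{n+1} ≤ C (aₙ + ∑_{k<n} a_{k+1} a_{n−k})`. [cite: BuckmasterCaolaboraGomezserrano2025, proof of Prop. 2.5] -/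
theorem abs_w_succ_le (hA : A ≠ 0) (n : ℕ) :
    |w r A (n + 1)| ≤ (3 * |r - 1| + 4) / |A| *
      (|w r A n| + ∑ k ∈ range n, |w r A (k + 1)| * |w r A (n - k)|) := by
  set a : ℕ → ℝ := fun i => |w r A i| with ha
  set S : ℝ := ∑ k ∈ range n, |w r A (k + 1)| * |w r A (n - k)| with hS
  have hA' : 0 < |A| := abs_pos.mpr hA
  have hS0 : 0 ≤ S := sum_nonneg fun k _ => mul_nonneg (abs_nonneg _) (abs_nonneg _)
  have han : 0 ≤ |w r A n| := abs_nonneg _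
  -- |rest| ≤ (n+1) ((|r-1| + 4/3) (a n + S))
  have hrest : |rest r (w r A) n| ≤ ((n : ℝ) + 1) * ((|r - 1| + 4 / 3) * (|w r A n| + S)) := by
    unfold rest
    have hn1 : (0 : ℝ) ≤ (n : ℝ) := Nat.cast_nonneg n
    -- first sum
    have h1 : |∑ k ∈ range n, vv (w r A) (k + 1) * dd (w r A) (n - (k + 1))|
        ≤ ((n : ℝ) + 1) * (|w r A n| + S) := by
      refine (abs_sum_le_sum_abs _ _).trans ?_
      have hterm : ∀ k ∈ range n, |vv (w r A) (k + 1) * dd (w r A) (n - (k + 1))|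
          ≤ ((n : ℝ) + 1) * ((if k = 0 then |w r A (n - k)| else 0)
              + |w r A (k + 1)| * |w r A (n - k)|) := by
        intro k hk
        rw [mem_range] at hk
        have hidx : n - (k + 1) + 1 = n - k := by omega
        rw [abs_mul]
        have hv : |vv (w r A) (k + 1)| ≤ (if k = 0 then 1 else 0) + |w r A (k + 1)| := by
          unfold vv
          refine (abs_add_le _ _).trans (add_le_add ?_ ?_)
          · by_cases hk0 : k = 0
            · subst hk0; simp
            · rw [if_neg (by omega : ¬ (k + 1 = 1)), if_neg hk0, abs_zero]
          · rw [abs_mul]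
            refine mul_le_of_le_one_left (abs_nonneg _) ?_
            unfold cc
            split_ifs <;> norm_num [abs_of_pos]
        have hd : |dd (w r A) (n - (k + 1))| ≤ ((n : ℝ) + 1) * |w r A (n - k)| := by
          unfold dd
          rw [abs_mul, hidx]
          gcongr
          rw [abs_of_nonneg (by positivity)]
          have : ((n - (k + 1) : ℕ) : ℝ) ≤ n := by exact_mod_cast Nat.sub_le n (k + 1)
          linarith
        calc |vv (w r A) (k + 1)| * |dd (w r A) (n - (k + 1))|
            ≤ ((if k = 0 then 1 else 0) + |w r A (k + 1)|) * (((n : ℝ) + 1) * |w r A (n - k)|) :=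
              mul_le_mul hv hd (abs_nonneg _) (by positivity)
          _ = ((n : ℝ) + 1) * ((if k = 0 then |w r A (n - k)| else 0)
              + |w r A (k + 1)| * |w r A (n - k)|) := by
              split_ifs <;> ring
      refine (sum_le_sum hterm).trans ?_
      rw [← mul_sum, sum_add_distrib, sum_ite_eq']
      gcongr
      split_ifs
      · simp
      · exact abs_nonneg _
    -- second sum
    have h2 : |1 / 6 * (1 - (-1) ^ (n + 1)) * ∑ k ∈ range n, w r A (k + 1) * w r A (n - k)|
        ≤ 1 / 3 * S := by
      rw [abs_mul]
      have hc : |1 / 6 * (1 - (-1 : ℝ) ^ (n + 1))| ≤ 1 / 3 := by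
        rcases neg_one_pow_eq_or ℝ (n + 1) with h | h <;> rw [h] <;> norm_num [abs_of_pos]
      have hs : |∑ k ∈ range n, w r A (k + 1) * w r A (n - k)| ≤ S := by
        refine (abs_sum_le_sum_abs _ _).trans ?_
        rw [hS]
        refine sum_le_sum fun k _ => ?_
        rw [abs_mul]
      exact mul_le_mul hc hs (abs_nonneg _) (by norm_num)
    have h0 : |(r - 1) * w r A n| = |r - 1| * |w r A n| := abs_mul _ _
    calc |(r - 1) * w r A n + ∑ k ∈ range n, vv (w r A) (k + 1) * dd (w r A) (n - (k + 1))
            + 1 / 6 * (1 - (-1) ^ (n + 1)) * ∑ k ∈ range n, w r A (k + 1) * w r A (n - k)|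
        ≤ |(r - 1) * w r A n| + |∑ k ∈ range n, vv (w r A) (k + 1) * dd (w r A) (n - (k + 1))|
            + |1 / 6 * (1 - (-1) ^ (n + 1)) * ∑ k ∈ range n, w r A (k + 1) * w r A (n - k)| :=
          abs_add_three _ _ _
      _ ≤ |r - 1| * |w r A n| + ((n : ℝ) + 1) * (|w r A n| + S) + 1 / 3 * S := by
          rw [h0]; gcongr
      _ ≤ ((n : ℝ) + 1) * ((|r - 1| + 4 / 3) * (|w r A n| + S)) := by
          have hr : 0 ≤ |r - 1| := abs_nonneg _
          nlinarith [mul_nonneg hr han, mul_nonneg hn1 hS0, mul_nonneg hn1 (mul_nonneg hr han),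
            mul_nonneg hn1 (mul_nonneg hr hS0), mul_nonneg hr hS0]
  -- |w_{n+1}| = |rest| / |lead| ≤ |rest| / (|A|/3 (n+1))
  have hlead := abs_lead_ge (w r A) n
  rw [w_zero] at hlead
  have hlead_pos : (0 : ℝ) < |A| / 3 * ((n : ℝ) + 1) := by positivity
  rw [w_succ]
  unfold next
  rw [abs_div, abs_neg]
  calc |rest r (w r A) n| / |lead (w r A) n|
      ≤ |rest r (w r A) n| / (|A| / 3 * ((n : ℝ) + 1)) :=
        div_le_div_of_nonneg_left (abs_nonneg _) hlead_pos hlead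
    _ ≤ ((n : ℝ) + 1) * ((|r - 1| + 4 / 3) * (|w r A n| + S)) / (|A| / 3 * ((n : ℝ) + 1)) := by
        gcongr
    _ = (3 * |r - 1| + 4) / |A| * (|w r A n| + S) := by
        field_simp

/-- The constant `C = (3|r−1| + 4)/|A|` of `abs_w_succ_le`. [folklore] -/
def C0 (r A : ℝ) : ℝ := (3 * |r - 1| + 4) / |A|

/-- The constant `B = |w₁| + 1`. [folklore] -/
def B0 (r A : ℝ) : ℝ := |w r A 1| + 1

/-- The growth rate `L = C(1 + 4B) + 1 ≥ 1` of the Catalan majorant. [folklore] -/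
def L0 (r A : ℝ) : ℝ := C0 r A * (1 + 4 * B0 r A) + 1

/-- [folklore] -/
theorem C0_nonneg : 0 ≤ C0 r A := by unfold C0; positivity

/-- [folklore] -/
theorem B0_pos : 0 < B0 r A := by unfold B0; positivity

/-- [folklore] -/
theorem one_le_L0 : 1 ≤ L0 r A := by
  unfold L0
  have := C0_nonneg (r := r) (A := A)
  have := B0_pos (r := r) (A := A)
  nlinarith

/-- **The Catalan majorant** (proof of Prop. 2.5): `|wₙ| ≤ B 𝔠ₙ Lⁿ⁻¹` for `n ≥ 1`.
[cite: BuckmasterCaolaboraGomezserrano2025, proof of Prop. 2.5] -/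
theorem abs_w_le_catalan (hA : A ≠ 0) {n : ℕ} (hn : 1 ≤ n) :
    |w r A n| ≤ B0 r A * catalan n * L0 r A ^ (n - 1) := by
  -- strong induction packaged as induction on an upper bound
  suffices H : ∀ N n : ℕ, 1 ≤ n → n ≤ N → |w r A n| ≤ B0 r A * catalan n * L0 r A ^ (n - 1) from
    H n n hn le_rfl
  intro N
  induction N with
  | zero => intro n hn hN; omega
  | succ N ih =>
    intro n hn hN
    rcases Nat.lt_or_ge n (N + 1) with hlt | hge
    · exact ih n hn (by omega)
    have hnN : n = N + 1 := le_antisymm hN hge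
    subst hnN
    rcases Nat.eq_zero_or_pos N with hN0 | hNpos
    · -- base case `n = 1`
      subst hN0
      simp [B0]
    -- inductive step `n = N + 1 ≥ 2`
    have hB := B0_pos (r := r) (A := A)
    have hL := one_le_L0 (r := r) (A := A)
    have hC := C0_nonneg (r := r) (A := A)
    have hkey := abs_w_succ_le (r := r) hA N
    set B := B0 r A
    set L := L0 r A
    set C := C0 r A with hCdef
    have hCeq : (3 * |r - 1| + 4) / |A| = C := rfl
    rw [hCeq] at hkey
    -- bounds on the terms
    have haN : |w r A N| ≤ B * catalan N * L ^ (N - 1) := ih N hNpos le_rfl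
    have hS : ∑ k ∈ range N, |w r A (k + 1)| * |w r A (N - k)|
        ≤ B ^ 2 * L ^ (N - 1) * catalan (N + 2) := by
      have hterm : ∀ k ∈ range N, |w r A (k + 1)| * |w r A (N - k)|
          ≤ B ^ 2 * L ^ (N - 1) * ((catalan (k + 1) : ℝ) * catalan (N - k)) := by
        intro k hk
        rw [mem_range] at hk
        have h1 : |w r A (k + 1)| ≤ B * catalan (k + 1) * L ^ (k + 1 - 1) := ih (k + 1) (by omega) (by omega)
        have h2 : |w r A (N - k)| ≤ B * catalan (N - k) * L ^ (N - k - 1) := ih (N - k) (by omega) (by omega)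
        have hexp : L ^ (k + 1 - 1) * L ^ (N - k - 1) = L ^ (N - 1) := by
          rw [← pow_add]; congr 1; omega
        calc |w r A (k + 1)| * |w r A (N - k)|
            ≤ (B * catalan (k + 1) * L ^ (k + 1 - 1)) * (B * catalan (N - k) * L ^ (N - k - 1)) :=
              mul_le_mul h1 h2 (abs_nonneg _) (by positivity)
          _ = B ^ 2 * (L ^ (k + 1 - 1) * L ^ (N - k - 1)) * ((catalan (k + 1) : ℝ) * catalan (N - k)) := by
              ring
          _ = B ^ 2 * L ^ (N - 1) * ((catalan (k + 1) : ℝ) * catalan (N - k)) := by rw [hexp]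
      refine (sum_le_sum hterm).trans ?_
      rw [← mul_sum]
      gcongr
      exact catalan_conv_le N
    have hc1 : (catalan N : ℝ) ≤ catalan (N + 1) := catalan_le_succ N
    have hc2 : (catalan (N + 2) : ℝ) ≤ 4 * catalan (N + 1) := catalan_succ_le (N + 1)
    have hcpos : (0 : ℝ) ≤ catalan (N + 1) := Nat.cast_nonneg _
    have hLpow : (0 : ℝ) < L ^ (N - 1) := pow_pos (by linarith) _
    -- assemble
    have hsum : |w r A N| + ∑ k ∈ range N, |w r A (k + 1)| * |w r A (N - k)|
        ≤ (B + 4 * B ^ 2) * catalan (N + 1) * L ^ (N - 1) := by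
      calc |w r A N| + ∑ k ∈ range N, |w r A (k + 1)| * |w r A (N - k)|
          ≤ B * catalan N * L ^ (N - 1) + B ^ 2 * L ^ (N - 1) * catalan (N + 2) := add_le_add haN hS
        _ ≤ B * catalan (N + 1) * L ^ (N - 1) + B ^ 2 * L ^ (N - 1) * (4 * catalan (N + 1)) := by
            gcongr
        _ = (B + 4 * B ^ 2) * catalan (N + 1) * L ^ (N - 1) := by ring
    calc |w r A (N + 1)|
        ≤ C * (|w r A N| + ∑ k ∈ range N, |w r A (k + 1)| * |w r A (N - k)|) := hkey
      _ ≤ C * ((B + 4 * B ^ 2) * catalan (N + 1) * L ^ (N - 1)) :=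
          mul_le_mul_of_nonneg_left hsum hC
      _ = B * catalan (N + 1) * (L ^ (N - 1) * (C * (1 + 4 * B))) := by ring
      _ ≤ B * catalan (N + 1) * (L ^ (N - 1) * L) := by
          gcongr
          show C * (1 + 4 * B) ≤ L
          simp only [L, L0, B, hCdef]
          linarith
      _ = B * catalan (N + 1) * L ^ (N + 1 - 1) := by
          rw [← pow_succ]; congr 2; omega

/-- The geometric bound: `|wₙ| ≤ K Mⁿ` with `M = 4L`, `K = max |A| B`.
[cite: BuckmasterCaolaboraGomezserrano2025, proof of Prop. 2.5] -/
def M0 (r A : ℝ) : ℝ := 4 * L0 r A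

/-- [folklore] -/
def K0 (r A : ℝ) : ℝ := max |A| (B0 r A)

/-- [folklore] -/
theorem M0_pos : 0 < M0 r A := by unfold M0; linarith [one_le_L0 (r := r) (A := A)]

/-- [folklore] -/
theorem K0_pos : 0 < K0 r A := by
  unfold K0
  exact lt_max_of_lt_right (B0_pos (r := r) (A := A))

/-- `|wₙ| ≤ K Mⁿ`. [cite: BuckmasterCaolaboraGomezserrano2025, proof of Prop. 2.5] -/
theorem abs_w_le (hA : A ≠ 0) (n : ℕ) : |w r A n| ≤ K0 r A * M0 r A ^ n := by
  rcases Nat.eq_zero_or_pos n with rfl | hn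
  · simp [K0]
  have h := abs_w_le_catalan (r := r) hA hn
  have hL := one_le_L0 (r := r) (A := A)
  have hB := B0_pos (r := r) (A := A)
  calc |w r A n| ≤ B0 r A * catalan n * L0 r A ^ (n - 1) := h
    _ ≤ B0 r A * 4 ^ n * L0 r A ^ n := by
        gcongr
        · exact catalan_le_four_pow n
        · omega
    _ = B0 r A * M0 r A ^ n := by unfold M0; rw [mul_pow]; ring
    _ ≤ K0 r A * M0 r A ^ n := by
        have hM : 0 ≤ M0 r A ^ n := pow_nonneg (M0_pos (r := r) (A := A)).le n
        refine mul_le_mul_of_nonneg_right ?_ hM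
        unfold K0
        exact le_max_right _ _

/-! ### The sum of the series: radius, derivative, and the equation (1.10) -/

/-- The radius `ρ = 1/(2M)` inside which everything below takes place. [folklore] -/
def rad (r A : ℝ) : ℝ := 1 / (2 * M0 r A)

/-- [folklore] -/
theorem rad_pos : 0 < rad r A := by
  unfold rad
  have := M0_pos (r := r) (A := A)
  positivity

/-- [folklore] -/
theorem M0_mul_rad : M0 r A * rad r A = 1 / 2 := by
  unfold rad
  have := (M0_pos (r := r) (A := A)).ne'
  field_simp

/-- `M|ζ| ≤ 1/2` inside the radius. [folklore] -/
theorem M0_mul_abs_le {ζ : ℝ} (hζ : |ζ| < rad r A) : M0 r A * |ζ| ≤ 1 / 2 := by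
  rw [← M0_mul_rad (r := r) (A := A)]
  exact mul_le_mul_of_nonneg_left hζ.le (M0_pos (r := r) (A := A)).le

/-- **The profile near the origin**: `𝒲(ζ) = ∑ wᵢ ζⁱ`. [cite: BuckmasterCaolaboraGomezserrano2025, Prop. 2.5, eq. (2.11)] -/
def profile (r A : ℝ) (ζ : ℝ) : ℝ := ∑' n, w r A n * ζ ^ n

/-- Term bound `|wₙ ζⁿ| ≤ K 2⁻ⁿ` inside the radius. [folklore] -/
theorem abs_term_le (hA : A ≠ 0) {ζ : ℝ} (hζ : |ζ| < rad r A) (n : ℕ) :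
    |w r A n * ζ ^ n| ≤ K0 r A * (1 / 2) ^ n := by
  have hK := (K0_pos (r := r) (A := A)).le
  have hM := (M0_pos (r := r) (A := A)).le
  rw [abs_mul, abs_pow]
  calc |w r A n| * |ζ| ^ n ≤ K0 r A * M0 r A ^ n * |ζ| ^ n := by
        gcongr; exact abs_w_le hA n
    _ = K0 r A * (M0 r A * |ζ|) ^ n := by rw [mul_pow]; ring
    _ ≤ K0 r A * (1 / 2) ^ n := by
        gcongr
        exact M0_mul_abs_le hζ

/-- Term bound for the derivative series `|(n+1) wₙ₊₁ ζⁿ| ≤ K M (n+1) 2⁻ⁿ`. [folklore] -/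
theorem abs_dd_term_le (hA : A ≠ 0) {ζ : ℝ} (hζ : |ζ| < rad r A) (n : ℕ) :
    |dd (w r A) n * ζ ^ n| ≤ K0 r A * M0 r A * (((n : ℝ) + 1) * (1 / 2) ^ n) := by
  have hK := (K0_pos (r := r) (A := A)).le
  have hM := (M0_pos (r := r) (A := A)).le
  unfold dd
  rw [abs_mul, abs_mul, abs_pow, abs_of_nonneg (by positivity : (0:ℝ) ≤ (n : ℝ) + 1)]
  calc ((n : ℝ) + 1) * |w r A (n + 1)| * |ζ| ^ n
      ≤ ((n : ℝ) + 1) * (K0 r A * M0 r A ^ (n + 1)) * |ζ| ^ n := by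
        gcongr; exact abs_w_le hA (n + 1)
    _ = K0 r A * M0 r A * (((n : ℝ) + 1) * (M0 r A * |ζ|) ^ n) := by rw [mul_pow]; ring
    _ ≤ K0 r A * M0 r A * (((n : ℝ) + 1) * (1 / 2) ^ n) := by
        gcongr
        exact M0_mul_abs_le hζ

/-- Term bound for the series of `𝒱`: `|vₙ ζⁿ| ≤ 𝟙_{n=1}|ζ|ⁿ + K 2⁻ⁿ`. [folklore] -/
theorem abs_vv_term_le (hA : A ≠ 0) {ζ : ℝ} (hζ : |ζ| < rad r A) (n : ℕ) :
    |vv (w r A) n * ζ ^ n| ≤ (if n = 1 then |ζ| ^ n else 0) + K0 r A * (1 / 2) ^ n := by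
  unfold vv
  rw [add_mul]
  refine (abs_add_le _ _).trans (add_le_add ?_ ?_)
  · split_ifs <;> simp [abs_pow]
  · rw [mul_assoc, abs_mul]
    refine (mul_le_of_le_one_left (abs_nonneg _) ?_).trans (abs_term_le hA hζ n)
    unfold cc
    split_ifs <;> norm_num [abs_of_pos]

/-- [folklore] -/
theorem summable_geom_half : Summable fun n : ℕ => (1 / 2 : ℝ) ^ n :=
  summable_geometric_of_lt_one (by norm_num) (by norm_num)

/-- [folklore] -/
theorem summable_succ_mul_geom_half : Summable fun n : ℕ => ((n : ℝ) + 1) * (1 / 2 : ℝ) ^ n := by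
  have h1 : Summable fun n : ℕ => (n : ℝ) ^ 1 * (1 / 2 : ℝ) ^ n :=
    summable_pow_mul_geometric_of_norm_lt_one 1 (by norm_num [abs_of_pos])
  simp only [pow_one] at h1
  have h2 := h1.add summable_geom_half
  refine h2.congr fun n => ?_
  ring

/-- Absolute summability of the profile series inside the radius. [folklore] -/
theorem summable_norm_term (hA : A ≠ 0) {ζ : ℝ} (hζ : |ζ| < rad r A) :
    Summable fun n => ‖w r A n * ζ ^ n‖ := by
  refine Summable.of_nonneg_of_le (fun n => norm_nonneg _) (fun n => ?_)
    (summable_geom_half.mul_left (K0 r A))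
  rw [Real.norm_eq_abs]
  exact abs_term_le hA hζ n

/-- Absolute summability of the derivative series inside the radius. [folklore] -/
theorem summable_norm_dd_term (hA : A ≠ 0) {ζ : ℝ} (hζ : |ζ| < rad r A) :
    Summable fun n => ‖dd (w r A) n * ζ ^ n‖ := by
  refine Summable.of_nonneg_of_le (fun n => norm_nonneg _) (fun n => ?_)
    (summable_succ_mul_geom_half.mul_left (K0 r A * M0 r A))
  rw [Real.norm_eq_abs]
  exact abs_dd_term_le hA hζ n

/-- Absolute summability of the `𝒱` series inside the radius. [folklore] -/
theorem summable_norm_vv_term (hA : A ≠ 0) {ζ : ℝ} (hζ : |ζ| < rad r A) :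
    Summable fun n => ‖vv (w r A) n * ζ ^ n‖ := by
  have h1 : Summable fun n : ℕ => (if n = 1 then |ζ| ^ n else 0) := summable_of_ne_finset_zero
    (s := {1}) (fun n hn => by rw [Finset.mem_singleton] at hn; rw [if_neg hn])
  refine Summable.of_nonneg_of_le (fun n => norm_nonneg _) (fun n => ?_)
    (h1.add (summable_geom_half.mul_left (K0 r A)))
  rw [Real.norm_eq_abs]
  exact abs_vv_term_le hA hζ n

/-- `HasSum (wₙ ζⁿ) (𝒲 ζ)` inside the radius. [folklore] -/
theorem hasSum_profile (hA : A ≠ 0) {ζ : ℝ} (hζ : |ζ| < rad r A) :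
    HasSum (fun n => w r A n * ζ ^ n) (profile r A ζ) :=
  (summable_norm_term hA hζ).of_norm.hasSum

/-- `𝒲(0) = w₀ = A`. [cite: BuckmasterCaolaboraGomezserrano2025, Prop. 2.5] -/
theorem profile_zero : profile r A 0 = A := by
  unfold profile
  rw [tsum_eq_single 0 (fun n hn => by simp [hn])]
  simp

/-- **Termwise differentiation**: `𝒲′(ζ) = ∑ (n+1) wₙ₊₁ ζⁿ` inside the radius.
[cite: BuckmasterCaolaboraGomezserrano2025, Prop. 2.5] -/
theorem hasDerivAt_profile (hA : A ≠ 0) {ζ : ℝ} (hζ : |ζ| < rad r A) :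
    HasDerivAt (profile r A) (∑' n, w r A n * ((n : ℝ) * ζ ^ (n - 1))) ζ := by
  have hK := (K0_pos (r := r) (A := A)).le
  have hM := (M0_pos (r := r) (A := A)).le
  -- uniform bound of the derivative terms on the ball
  set u : ℕ → ℝ := fun n => K0 r A * M0 r A * (2 * ((n : ℝ) * (1 / 2) ^ n)) with hu
  have hu_sum : Summable u := by
    have h1 : Summable fun n : ℕ => (n : ℝ) ^ 1 * (1 / 2 : ℝ) ^ n :=
      summable_pow_mul_geometric_of_norm_lt_one 1 (by norm_num [abs_of_pos])
    simp only [pow_one] at h1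
    exact (h1.mul_left 2).mul_left (K0 r A * M0 r A)
  have hball : ∀ y : ℝ, y ∈ Metric.ball (0 : ℝ) (rad r A) → |y| < rad r A := fun y hy => by
    simpa [Real.dist_eq] using hy
  have hg' : ∀ (n : ℕ) (y : ℝ), y ∈ Metric.ball (0 : ℝ) (rad r A) →
      ‖w r A n * ((n : ℝ) * y ^ (n - 1))‖ ≤ u n := by
    intro n y hy
    have hy' := hball y hy
    rw [Real.norm_eq_abs]
    rcases Nat.eq_zero_or_pos n with rfl | hn
    · simp [hu]
    obtain ⟨m, rfl⟩ : ∃ m, n = m + 1 := ⟨n - 1, by omega⟩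
    simp only [hu, Nat.add_sub_cancel]
    rw [abs_mul, abs_mul, abs_pow, abs_of_nonneg (by positivity : (0:ℝ) ≤ ((m + 1 : ℕ) : ℝ))]
    calc |w r A (m + 1)| * ((((m + 1 : ℕ)) : ℝ) * |y| ^ m)
        ≤ K0 r A * M0 r A ^ (m + 1) * ((((m + 1 : ℕ)) : ℝ) * |y| ^ m) := by
          gcongr; exact abs_w_le hA (m + 1)
      _ = K0 r A * M0 r A * ((((m + 1 : ℕ)) : ℝ) * (M0 r A * |y|) ^ m) := by rw [mul_pow]; ring
      _ ≤ K0 r A * M0 r A * ((((m + 1 : ℕ)) : ℝ) * (1 / 2) ^ m) := by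
          gcongr
          exact M0_mul_abs_le hy'
      _ = K0 r A * M0 r A * (2 * ((((m + 1 : ℕ)) : ℝ) * (1 / 2) ^ (m + 1))) := by ring
  have hg : ∀ (n : ℕ) (y : ℝ), y ∈ Metric.ball (0 : ℝ) (rad r A) →
      HasDerivAt (fun x => w r A n * x ^ n) (w r A n * ((n : ℝ) * y ^ (n - 1))) y :=
    fun n y _ => (hasDerivAt_pow n y).const_mul (w r A n)
  have h0 : (0 : ℝ) ∈ Metric.ball (0 : ℝ) (rad r A) := Metric.mem_ball_self rad_pos
  have hsum0 : Summable fun n => w r A n * (0 : ℝ) ^ n :=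
    (summable_norm_term hA (by simpa using rad_pos (r := r) (A := A))).of_norm
  have hζ' : ζ ∈ Metric.ball (0 : ℝ) (rad r A) := by simpa [Real.dist_eq] using hζ
  exact hasDerivAt_tsum_of_isPreconnected hu_sum Metric.isOpen_ball
    (convex_ball (0 : ℝ) (rad r A)).isPreconnected hg hg' h0 hsum0 hζ'

/-- `HasSum ((n+1)wₙ₊₁ ζⁿ) (𝒲′ ζ)` inside the radius. [cite: BuckmasterCaolaboraGomezserrano2025, Prop. 2.5] -/
theorem hasSum_deriv_profile (hA : A ≠ 0) {ζ : ℝ} (hζ : |ζ| < rad r A) :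
    HasSum (fun n => dd (w r A) n * ζ ^ n) (deriv (profile r A) ζ) := by
  rw [(hasDerivAt_profile hA hζ).deriv]
  -- summability of the un-shifted derivative series
  have hs : Summable fun n => w r A n * ((n : ℝ) * ζ ^ (n - 1)) := by
    have h1 := (summable_norm_dd_term hA hζ).of_norm
    rw [← summable_nat_add_iff 1]
    refine h1.congr fun n => ?_
    simp only [dd, Nat.add_sub_cancel, Nat.cast_succ]
    ring
  have h2 := (hasSum_nat_add_iff' 1).mpr hs.hasSum
  simp only [sum_range_one, Nat.cast_zero, zero_mul, mul_zero, sub_zero] at h2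
  refine (h2.congr_fun ?_ : _)
  intro n
  simp only [dd, Nat.add_sub_cancel, Nat.cast_succ]
  ring

/-- `𝒲′(0) = w₁ = 1 − r`. [cite: BuckmasterCaolaboraGomezserrano2025, Prop. 2.5] -/
theorem deriv_profile_zero (hA : A ≠ 0) : deriv (profile r A) 0 = 1 - r := by
  have h := hasSum_deriv_profile hA (ζ := 0) (by simpa using rad_pos (r := r) (A := A))
  have h2 : HasSum (fun n => dd (w r A) n * (0 : ℝ) ^ n) (dd (w r A) 0 * (0 : ℝ) ^ 0) :=
    hasSum_single 0 (fun n hn => by simp [hn])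
  rw [h.unique h2]
  simp [dd, w_one hA]

/-- The series of `𝒱 = ζ + ½(𝒲(ζ) − 𝒲(−ζ)) + ⅙(𝒲(ζ) + 𝒲(−ζ))` is `∑ vₙ ζⁿ`.
[cite: BuckmasterCaolaboraGomezserrano2025, eq. (2.11)] -/
theorem hasSum_vv (hA : A ≠ 0) {ζ : ℝ} (hζ : |ζ| < rad r A) :
    HasSum (fun n => vv (w r A) n * ζ ^ n)
      (ζ + 1 / 2 * (profile r A ζ - profile r A (-ζ) + 1 / 3 * (profile r A ζ + profile r A (-ζ)))) := by
  have hW := hasSum_profile hA hζ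
  have hWn := hasSum_profile hA (ζ := -ζ) (by simpa using hζ)
  have h := (hasSum_ite_eq 1 ζ).add (((hW.sub hWn).add ((hW.add hWn).mul_left (1 / 3))).mul_left (1 / 2))
  refine (h.congr_fun fun n => ?_ : _)
  show vv (w r A) n * ζ ^ n = (if n = 1 then ζ else 0)
    + 1 / 2 * ((w r A n * ζ ^ n - w r A n * (-ζ) ^ n) + 1 / 3 * (w r A n * ζ ^ n + w r A n * (-ζ) ^ n))
  unfold vv cc
  rcases Nat.even_or_odd n with he | ho
  · have hn1 : n ≠ 1 := fun h => by simp [h] at he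
    rw [if_neg hn1, if_neg hn1, if_pos he, he.neg_pow]
    ring
  · rw [if_neg (Nat.not_even_iff_odd.mpr ho), ho.neg_pow]
    split_ifs with h1
    · subst h1; ring
    · ring

/-- Cauchy product, rearranged: `∑_{k≤n} (f_k ζᵏ)(g_{n−k} ζⁿ⁻ᵏ) = (∑_{k≤n} f_k g_{n−k}) ζⁿ`. [folklore] -/
theorem sum_range_mul_pow (f g : ℕ → ℝ) (ζ : ℝ) (n : ℕ) :
    ∑ k ∈ range (n + 1), f k * ζ ^ k * (g (n - k) * ζ ^ (n - k))
      = (∑ k ∈ range (n + 1), f k * g (n - k)) * ζ ^ n := by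
  rw [sum_mul]
  refine sum_congr rfl fun k hk => ?_
  rw [mem_range] at hk
  rw [← pow_mul_pow_sub ζ (Nat.lt_succ_iff.mp hk)]
  ring

/-- **Proposition 2.5, first half, at `α = 1/3`: the series solves (1.10) near the origin.**
For `0 < |ζ| < ρ`,
`(r−1)𝒲(ζ) + (ζ + ½(𝒲(ζ) − 𝒲(−ζ) + ⅓(𝒲(ζ) + 𝒲(−ζ)))) 𝒲′(ζ) + (1/(6ζ))(𝒲(ζ)² − 𝒲(−ζ)²) = 0`.
[cite: BuckmasterCaolaboraGomezserrano2025, Prop. 2.5] -/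
theorem profile_eq (hA : A ≠ 0) {ζ : ℝ} (hζ0 : ζ ≠ 0) (hζ : |ζ| < rad r A) :
    (r - 1) * profile r A ζ
        + (ζ + 1 / 2 * (profile r A ζ - profile r A (-ζ)
            + 1 / 3 * (profile r A ζ + profile r A (-ζ)))) * deriv (profile r A) ζ
        + 1 / 3 / (2 * ζ) * (profile r A ζ ^ 2 - profile r A (-ζ) ^ 2) = 0 := by
  have hζn : |(-ζ)| < rad r A := by simpa using hζ
  -- the basic sums
  have hW := hasSum_profile hA hζ
  have hWn := hasSum_profile hA hζn
  have hV := hasSum_vv hA hζ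
  have hD := hasSum_deriv_profile hA hζ
  set W0 := profile r A ζ with hW0
  set W1 := profile r A (-ζ) with hW1
  set V := ζ + 1 / 2 * (W0 - W1 + 1 / 3 * (W0 + W1)) with hVdef
  set D := deriv (profile r A) ζ with hDdef
  -- Cauchy products
  have hP1 := hasSum_sum_range_mul_of_summable_norm (summable_norm_vv_term hA hζ)
    (summable_norm_dd_term hA hζ)
  rw [hV.tsum_eq, hD.tsum_eq] at hP1
  have hP2 := hasSum_sum_range_mul_of_summable_norm (summable_norm_term hA hζ)
    (summable_norm_term hA hζ)
  rw [hW.tsum_eq] at hP2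
  have hP3 := hasSum_sum_range_mul_of_summable_norm (summable_norm_term hA hζn)
    (summable_norm_term hA hζn)
  rw [hWn.tsum_eq] at hP3
  simp only [sum_range_mul_pow] at hP1 hP2 hP3
  -- the series `s n = ∑_{k≤n} w_k w_{n-k}`
  set s : ℕ → ℝ := fun n => ∑ k ∈ range (n + 1), w r A k * w r A (n - k) with hs
  -- T1 = ζ((r-1)W0 + V D), T3 = (1/6)(W0² - W1²)
  have hT1 : HasSum (fun n => ζ * (((r - 1) * w r A n
      + ∑ k ∈ range (n + 1), vv (w r A) k * dd (w r A) (n - k)) * ζ ^ n))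
      (ζ * ((r - 1) * W0 + V * D)) := by
    have := ((hW.mul_left (r - 1)).add hP1).mul_left ζ
    refine this.congr_fun fun n => ?_
    ring
  have hT3 : HasSum (fun n => 1 / 6 * (s n * ζ ^ n - s n * (-ζ) ^ n))
      (1 / 6 * (W0 * W0 - W1 * W1)) := (hP2.sub hP3).mul_left (1 / 6)
  -- shift T3 by one (its zeroth term vanishes)
  have hT3' : HasSum (fun n => 1 / 6 * (s (n + 1) * ζ ^ (n + 1) - s (n + 1) * (-ζ) ^ (n + 1)))
      (1 / 6 * (W0 * W0 - W1 * W1)) := by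
    have := (hasSum_nat_add_iff' 1).mpr hT3
    simpa using this
  have hsum := hT1.add hT3'
  -- the summand is `e_n(w) ζ^{n+1} = 0`
  have hF : ∀ n : ℕ, ζ * (((r - 1) * w r A n
      + ∑ k ∈ range (n + 1), vv (w r A) k * dd (w r A) (n - k)) * ζ ^ n)
      + 1 / 6 * (s (n + 1) * ζ ^ (n + 1) - s (n + 1) * (-ζ) ^ (n + 1)) = 0 := by
    intro n
    have he := ee_w (r := r) hA n
    unfold ee at he
    rw [neg_pow]
    simp only [hs] at *
    linear_combination ζ ^ (n + 1) * he
  simp only [hF] at hsum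
  have h0 : ζ * ((r - 1) * W0 + V * D) + 1 / 6 * (W0 * W0 - W1 * W1) = 0 :=
    hsum.unique hasSum_zero
  -- divide by ζ
  have key : ζ * ((r - 1) * W0 + V * D + 1 / 3 / (2 * ζ) * (W0 ^ 2 - W1 ^ 2)) = 0 := by
    rw [← h0]
    field_simp
    ring
  exact (mul_eq_zero.mp key).resolve_left hζ0

/-- **Analyticity**: the profile has the power series `∑ wᵢ ζⁱ` on the ball of radius `ρ`, in
particular it is analytic at every point of the ball. [cite: BuckmasterCaolaboraGomezserrano2025, Prop. 2.5] -/
theorem analyticAt_profile (hA : A ≠ 0) {ζ : ℝ} (hζ : |ζ| < rad r A) :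
    AnalyticAt ℝ (profile r A) ζ := by
  have hK := (K0_pos (r := r) (A := A)).le
  have hM := M0_pos (r := r) (A := A)
  set p := FormalMultilinearSeries.ofScalars ℝ (w r A) with hp
  -- radius ≥ 1/M
  let Minv : NNReal := ⟨(M0 r A)⁻¹, inv_nonneg.mpr hM.le⟩
  have hrad : ((Minv : NNReal) : ENNReal) ≤ p.radius := by
    refine p.le_radius_of_bound (K0 r A) fun n => ?_
    rw [hp, FormalMultilinearSeries.ofScalars_norm, Real.norm_eq_abs]
    show |w r A n| * ((M0 r A)⁻¹) ^ n ≤ K0 r A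
    calc |w r A n| * ((M0 r A)⁻¹) ^ n ≤ K0 r A * M0 r A ^ n * ((M0 r A)⁻¹) ^ n := by
          gcongr; exact abs_w_le hA n
      _ = K0 r A := by rw [mul_assoc, ← mul_pow, mul_inv_cancel₀ hM.ne', one_pow, mul_one]
  have hMinv_pos : (0 : ENNReal) < ((Minv : NNReal) : ENNReal) := by
    have : (0 : NNReal) < Minv := by
      show (0 : ℝ) < (M0 r A)⁻¹
      exact inv_pos.mpr hM
    exact_mod_cast this
  have hps : HasFPowerSeriesOnBall p.sum p 0 ((Minv : NNReal) : ENNReal) :=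
    (p.hasFPowerSeriesOnBall (hMinv_pos.trans_le hrad)).mono hMinv_pos hrad
  have hfun : p.sum = profile r A := by
    show FormalMultilinearSeries.ofScalarsSum (E := ℝ) (w r A) = profile r A
    rw [FormalMultilinearSeries.ofScalarsSum_eq_tsum]
    funext x
    simp [profile, smul_eq_mul]
  rw [← hfun]
  refine hps.analyticAt_of_mem ?_
  rw [Metric.eball_coe, Metric.mem_ball, Real.dist_eq, sub_zero]
  show |ζ| < (M0 r A)⁻¹
  calc |ζ| < rad r A := hζ
    _ ≤ (M0 r A)⁻¹ := by
        unfold rad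
        rw [div_le_iff₀ (by positivity), inv_mul_eq_div, le_div_iff₀ hM]
        linarith

/-- **Proposition 2.5 of Buckmaster–Cao-Labora–Gómez-Serrano, first half, at `γ = 5/3`
(`α = 1/3`).** For every `A ≠ 0` (and every `r`) the single profile equation (1.10) has, in a
neighbourhood of `ζ = 0`, a solution given by a convergent power series with `𝒲(0) = A` (and then
`𝒲′(0) = 1 − r`): "For any `A > 0`, there exists a solution `𝒲` to (1.10) in a neighborhood of
`ζ = 0` which can be written in terms of a convergent power series `𝒲(ζ) = ∑ wᵢ ζⁱ` such that
`w₀ = A`." [cite: BuckmasterCaolaboraGomezserrano2025, Prop. 2.5] -/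
theorem exists_originSeries (r : ℝ) {A : ℝ} (hA : A ≠ 0) :
    ∃ 𝒲 : ℝ → ℝ, ∃ ρ : ℝ, 0 < ρ ∧ 𝒲 0 = A ∧ deriv 𝒲 0 = 1 - r ∧
      (∀ ζ : ℝ, |ζ| < ρ → AnalyticAt ℝ 𝒲 ζ) ∧
      ∀ ζ : ℝ, ζ ≠ 0 → |ζ| < ρ →
        (r - 1) * 𝒲 ζ + (ζ + 1 / 2 * (𝒲 ζ - 𝒲 (-ζ) + 1 / 3 * (𝒲 ζ + 𝒲 (-ζ)))) * deriv 𝒲 ζ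
          + 1 / 3 / (2 * ζ) * (𝒲 ζ ^ 2 - 𝒲 (-ζ) ^ 2) = 0 :=
  ⟨profile r A, rad r A, rad_pos, profile_zero, deriv_profile_zero hA,
    fun _ hζ => analyticAt_profile hA hζ, fun _ hζ0 hζ => profile_eq hA hζ0 hζ⟩

/-- `𝒲′(0) = 1 − r` as a `HasDerivAt` statement (the input form used by
`Monatomic.exists_trajectory_of_profile`). [cite: BuckmasterCaolaboraGomezserrano2025, Prop. 2.5] -/
theorem hasDerivAt_profile_zero (hA : A ≠ 0) : HasDerivAt (profile r A) (1 - r) 0 := by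
  have h0 : |(0 : ℝ)| < rad r A := by rw [abs_zero]; exact rad_pos
  have h := (hasDerivAt_profile hA h0).differentiableAt.hasDerivAt
  rwa [deriv_profile_zero hA] at h

/-- Differentiability of the profile inside the radius. [cite: BuckmasterCaolaboraGomezserrano2025, Prop. 2.5] -/
theorem differentiableAt_profile (hA : A ≠ 0) {ζ : ℝ} (hζ : |ζ| < rad r A) :
    DifferentiableAt ℝ (profile r A) ζ :=
  (hasDerivAt_profile hA hζ).differentiableAt

/-- **Proposition 2.5, first part, in the input form of the second part**: for `A > 0` the
origin series `𝒲 = profile r A` has `𝒲(0) = A > 0`, `𝒲′(0) = 1 − r`, is differentiable on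
`|ζ| < rad r A` and solves (1.10) there off `ζ = 0`. [cite: BuckmasterCaolaboraGomezserrano2025, Prop. 2.5] -/
theorem originSeries_input {A : ℝ} (hA : 0 < A) :
    0 < rad r A ∧ 0 < profile r A 0 ∧ HasDerivAt (profile r A) (1 - r) 0 ∧
      (∀ ζ : ℝ, |ζ| < rad r A → DifferentiableAt ℝ (profile r A) ζ) ∧
      ∀ ζ : ℝ, ζ ≠ 0 → |ζ| < rad r A →
        (r - 1) * profile r A ζ
          + (ζ + 1 / 2 * (profile r A ζ - profile r A (-ζ)
              + 1 / 3 * (profile r A ζ + profile r A (-ζ)))) * deriv (profile r A) ζ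
          + 1 / 3 / (2 * ζ) * (profile r A ζ ^ 2 - profile r A (-ζ) ^ 2) = 0 :=
  ⟨rad_pos, by rw [profile_zero]; exact hA, hasDerivAt_profile_zero hA.ne',
    fun _ hζ => differentiableAt_profile hA.ne' hζ, fun _ hζ0 hζ => profile_eq hA.ne' hζ0 hζ⟩

end OriginSeries

end BuckmasterCaolaboraGomezserrano2025

end Literature.Analysis.FluidPDE
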